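import Mathlib
import HarnessLib

/-!
# Hintz 2026, *Nonlinear stability of subextremal Kerr black holes*: the proof ARCHITECTURE of Thm 13.1, typed
# (statement shapes over an abstract carrier; parameter order and bookkeeping edges proved; no analysis)

CITATION HEADER (lean-in-tree rule 2026-08-18).  P. Hintz, arXiv:2606.28253 **v2** (2026-08-03), 339 pp., bib key
`Hintz2026` — an UNREFEREED CLAIM under adjudication in this library: its main theorem is the named claim
`Literature.Geometry.Lorentzian.hintz_kerr_stability_subextremal_cauchy` (`@[claim "Hintz2026" "under-review"]`,
file `KerrStabilitySubextremalCauchy.lean`); companions arXiv:2606.27658 ("[CD]", constraint damping) and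
arXiv:2606.28008 ("[AF]", linear waves on asymptotically flat spacetimes) are likewise unrefereed; the mode-stability
input is L. Andersson, D. Häfner, B. Whiting, JEMS (2024) ("AHW", refereed).  TeX line numbers `l.N` refer to the v2
source `kerr-stab-r.tex`; theorem numbers are those of v2.  This module is the audit cell `pub-kerr`'s "Root H" shape
file (HINTZ-PLAN.md P6): it types the SPINE of the printed proof of Thm 13.1 (`ThmSt`, pp. 318–323, proof
l.15117–15215, Steps 1–4) at statement level, in the style of the cell's Klainerman–Szeftel skeleton
(`Literature.Geometry.Lorentzian.KlainermanSzeftel2021.{Bootstrap,Dag}`): every analytic node is a predicate on an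
abstract carrier (a HYPOTHESIS node — over an arbitrary carrier none of them is a theorem and no `_holds` is
expected), the numeric parameters the proof fixes are honest real numbers, and what the kernel PROVES is exactly the
bookkeeping the printed text performs between the nodes.  Nothing here asserts, re-proves or disputes an estimate;
nothing here is Final-State-Conjecture progress.

WHAT IS TYPED, and what the kernel checks.
* **Step 1 (l.15119), the parameter-fixing order** (the cell's risk item R1).  The printed quantifier shapes of the
  three parameter-dependent leaves — Thm 7.1 (`Thm71Shape`: fix `v^𝓒 ∈ (0,1)`, `C₀ > 0`; ∃ `e^𝓒 ∈ (0,1)`, `𝔡^𝓒`;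
  ∀ sufficiently large `γ^𝓒 > 1`), Prop 6.12 (`Prop612Shape`: ∃ `ε₀` ∀ `γ^Υ_{𝓗⁺} ∈ (0,ε₀]` ∃ `ε₁` ∀ `e^Υ ∈ [0,ε₁]`,
  `|γ^Υ| < ε₁`), Prop 8.6 (`Prop86Shape`: all other parameters and 1-forms fixed FIRST, then ∀ sufficiently small
  `γ^Υ > 0`) — compose: `step1_exists` PROVES that parameters with `v^𝓒 = ½`, `C₀ = 100`,
  `(1−e^𝓒)(1−v^𝓒)γ^𝓒 > 100`, the conclusions of Thm 7.1 / Prop 6.12 / Prop 8.6, and `1 + 2γ^Υ < min Re 𝓔₀` exist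
  (the dependency graph of the "sufficiently small/large" choices is acyclic as printed); `step1_exists'` adds the
  hypothesis `e^Υ(γ^Υ)² < 3/4` that Lemma 6.6's simplicity clause leaves implicit
  (`Hintz2026/IndicialRoots.lean`), still within the printed order.
* **The parameter windows** of Thm 10.1 (`α_𝒮 + 3/2 ∈ (0, ε_ind)`, `δ > α_𝒮 + 3/2`, l.9789–9792), Cor 11.10
  (`δ < ε_ind`, `ℓ_𝒥 < min(2γ^Υ, ½)`, `ℓ₊ ∈ (δ,1)`, `ℓ_𝒦 ∈ (2, 2+ε_𝒦]`, l.11008–11013) and Thm 11.12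
  (`β₊ ∈ (½, ½+ε_ind)`, `β_𝒥 ∈ (β₊,1)`, `δ > β₊ − ½`, l.11028): `windows_nonempty` — all inhabited as soon as
  `0 < ε_ind ≤ 1`, `γ^Υ > 0`, `ε_𝒦 > 0` (`ε_ind ≤ 1` because `1` is an `s0` indicial root of `L̂_b(0)`, Lemma 8.4
  l.7549; the text's "and thus `< 1`", l.11008).
* **Prop 8.8 (`PropWEMode`, mode stability of `L_b` for `σ ≠ 0`)**: its printed three-line proof (l.7746–7757) is
  pure bookkeeping modulo five inputs — the second Bianchi identity, Thm 7.1(1), the definition of `L_b`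
  (eq. `EqWEOp`, l.7248–7251), AHW Thm 6.1(1), the identity `□^Υ = 2δ_{E^Υ}𝖦δ*` (eq. `Eq1BoxUps`, l.4175–4178) and Prop 6.12 — and is PROVED as
  `propWEMode_injective` over an abstract `ModeData` (weights `α` carried as indices, so that the quantifier detail
  "`ω ∈ 𝒜^{α'}` for SOME `α'`" vs "Prop 6.12 for ALL weights" is visible).
* **Thm 11.12 ⇐ [AF] Thm F ∘ Cor 11.10 ⇐ {Thm 10.1 ⇐ Props 8.3, 8.6 + low-energy estimate; Prop 11.6}**
  (l.9794, l.11008–11024): `thm1112_of_leaves`, composition of named hypothesis nodes.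
* **Step 2 (l.15124–15156)**: the numeric hypotheses of Thm 5.21 at `ℓ₀ = 3+ε₀`, `ℓ_𝒥 = 3+ε_𝒥` follow from Step 1
  (`thm521_numeric_hyps_of_step1`), EXCEPT the side condition "`ℓ₀ ∉ Re π₁𝓔₀`" (l.5319), which Thm 13.1's
  hypotheses on `𝓔₀` (l.15040) do not supply: it is carried as the explicit hypothesis `SideCond521` of the Step-2
  edge, and `sideCond521_repairable` PROVES the one-line repair (shrink `ε₀` within `(ε₀/2, ε₀]`, possible because
  `Re π₁𝓔₀` is locally finite, Def 2.7 "Index sets", l.2359–2369, p. 47) — the cell records this as an observation, not a gap.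
* **Steps 3–4 (l.15160–15214)** and the reduction Thm 1.1 ⇐ Thm 13.1 (l.15080): the Saint-Raymond Nash–Moser
  scheme's four printed checks ((1) `𝒞²` map = Thm 12.3; (2) tame forward estimates "as usual, from Moser-type
  estimates"; (3) linearised solvability with tame estimates = Thm 12.8, "which merely repackages" Cor 11.66;
  (4) smoothing operators = Gluing II Lemma 6.12/Cor 6.14) and the Step-4 gluing + constraint propagation are typed as
  named hypothesis nodes over `NMNodes`; `thmSt_of_steps` is their composition.  These edges are propositional:
  their value is the kernel-recorded NODE LIST with loci, each usable as an audit ledger key.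

STATUS OF THE SOURCE.  Unrefereed (v2); the cell's scoped verification plan, measured DAG (130 statements, 362
edges, depth 30), new-vs-imported table, v1→v2 diff and costed audit are `run/shared/lean/pub/pub-kerr/HINTZ-PLAN.md`;
the `|a| ≪ M` census it complements is `ADEP.md` §D–§E.  Companion statements ([AF] Thm F, Defs 5.8/5.13/5.18;
[CD] Thms T/M0/MiInv) enter only as names in docstrings.  Deliberately NOT here: function spaces, the operators
themselves, the `b`-dependence ("for `b` sufficiently close to `b₀`", uniform in every node), §§9–11 below the level of
Thm 11.12 / Cor 11.66, Thm 13.5, and the data-class comparison (`Hintz2026/DataClasses.lean`).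

## References
* P. Hintz, arXiv:2606.28253v2 (2026): Def 2.7 (p. 47), Def 4.1/4.2 (pp. 81–82), Thm 5.17/5.21/5.23, Prop 5.25
  (pp. 101–110), Lemma 6.6, Lemma 6.11, Prop 6.12 (pp. 117–121), Thm 7.1 (p. 136), §8 preamble (p. 145,
  l.7241–7252), Prop 8.3, Lemma 8.4, Prop 8.6, Prop 8.8 (pp. 147–153), Thm 10.1 (p. 199), Prop 11.6, Cor 11.10,
  Thm 11.12 (pp. 223–225), Cor 11.66 (p. 294), Thm 12.3, Thm 12.8 (pp. 310–312), Thm 13.1 and its proof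
  (pp. 318–323); printed pages = running heads of the v2 PDF.  Key `Hintz2026`.
* L. Andersson, D. Häfner, B. F. Whiting, *Mode analysis for the linearized Einstein equations on the Kerr metric:
  the large 𝔞 case*, JEMS (2024), doi:10.4171/jems/1544, Thms 5.1, 6.1(1) (as cited at l.6168, l.7752).
* X. Saint-Raymond, *A simple Nash–Moser implicit function theorem*, Enseign. Math. 35 (1989) (as cited l.15171).
-/

noncomputable section

namespace Literature.Geometry.Lorentzian.Hintz2026.Architecture

/-! ## The numeric parameters and the carrier -/

/-- Numeric part of the constraint-damping modification `E^𝓒 = (𝔡^𝓒, e^𝓒, γ^𝓒)` of Def 4.2 (l.4188–4199) together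
with the two constants fixed when Thm 7.1 is applied: `v^𝓒 ∈ (0,1)` (the far-field form
`𝔡^𝓒 = r^{-1}(dt − v^𝓒 dr)`) and `C₀ > 0`; the 1-form `𝔡^𝓒` itself is not modelled.
[cite: Hintz2026, Def 4.2 and Thm 7.1, TeX l.4188-4199, l.6820-6822 (transcription; claim under review)] -/
structure CDParams where
  /-- `v^𝓒 ∈ (0,1)` (Def 4.2; Step 1 takes `v^𝓒 = 1/2`). -/
  vC : ℝ
  /-- `e^𝓒` ("small", footnote l.4190; produced by Thm 7.1). -/
  eC : ℝ
  /-- `γ^𝓒` ("large"; Thm 7.1: "for all sufficiently large `γ^𝓒 > 1`"). -/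
  γC : ℝ
  /-- `C₀ > 0` of Thm 7.1 (Step 1: `C₀ = 100`). -/
  C0 : ℝ

/-- Numeric part of the gauge modification `E^Υ = (𝔡^Υ, e^Υ, γ^Υ; 𝔡^Υ_{𝓗⁺}, γ^Υ_{𝓗⁺})` of Def 4.1 (l.4142–4159);
the 1-forms `𝔡^Υ` (`= r^{-1}dt` for large `r`) and `𝔡^Υ_{𝓗⁺}` (Lemma 6.11) are fixed data, not modelled.
"We will ultimately choose `e^Υ, γ^Υ, γ^Υ_{𝓗⁺} > 0` small" (footnote, l.4144).
[cite: Hintz2026, Def 4.1, TeX l.4142-4159 (transcription; claim under review)] -/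
structure GaugeParams where
  /-- `e^Υ`. -/
  eU : ℝ
  /-- `γ^Υ`. -/
  γU : ℝ
  /-- `γ^Υ_{𝓗⁺}`. -/
  γH : ℝ

/-- **Carrier.**  The data Thm 13.1 fixes (subextremal `b₀ = (𝔪₀, 𝔞₀)`, `|𝔞₀| < 𝔪₀`, l.15036; the remainder order
`ε₀ > 0` and the index set `𝓔₀` through `min Re 𝓔₀ > 1 + ε₀`, l.15040, and through the locally finite set
`Re π₁𝓔₀ ⊂ ℝ` of Def 2.7 "Index sets", l.2359–2369) and the CONCLUSIONS of the parameter-dependent analytic nodes of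
§§6–8 as opaque predicates of the numeric parameters (every such node is stated in print "for `b` sufficiently
close to `b₀`", a uniform clause not modelled).  A predicate on settings: nothing is asserted.
[cite: Hintz2026, Thm 13.1 (hypotheses), TeX l.15036-15040; Def 2.7 (index sets) l.2359-2369 (transcription; claim under review)] -/
structure Setting where
  /-- `𝔪₀`. -/
  m0 : ℝ
  /-- `𝔞₀`. -/
  a0 : ℝ
  /-- `|𝔞₀| < 𝔪₀` (l.15036). -/
  subextremal : |a0| < m0
  /-- `ε₀ > 0` of Thm 13.1 (l.15040). -/
  ε0 : ℝ
  ε0_pos : 0 < ε0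
  /-- `min Re 𝓔₀`. -/
  minReE0 : ℝ
  /-- `min Re 𝓔₀ > 1 + ε₀` (l.15040). -/
  minReE0_gt : 1 + ε0 < minReE0
  /-- `Re π₁ 𝓔₀ ⊂ ℝ` (Def 2.7, item "Exponents", l.2369). -/
  ReExpE0 : Set ℝ
  /-- an index set has "only finitely many pairwise distinct `(z,k)` … with `Re z ≤ C`" for every `C` (l.2366). -/
  ReExpE0_locFinite : ∀ C : ℝ, (ReExpE0 ∩ Set.Iic C).Finite
  /-- conclusions (1)–(4) of Thm 7.1 for `□^𝓒_{g_b,E^𝓒}` at these `(v^𝓒, e^𝓒, γ^𝓒, C₀)` (l.6823–6833). -/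
  CD : CDParams → Prop
  /-- conclusion of Prop 6.12: mode stability of `□^Υ_{g_b,E^Υ}`, all `Im σ ≥ 0` (l.6196–6199). -/
  MSU : GaugeParams → Prop
  /-- Lemma 8.4's `ε_ind > 0` for `L_b` built from `(E^𝓒, E^Υ)` (l.7557–7561; depends on both modifications). -/
  epsInd : CDParams → GaugeParams → ℝ
  /-- conclusion of Prop 8.6: `L_b` is tf-admissible with every weight `β ∈ (0, ε_ind)` (l.7653–7660). -/
  TF : CDParams → GaugeParams → Prop

/-! ## Step 1 of the proof of Thm 13.1 (l.15119): the printed quantifier shapes and their composition -/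

/-- **Thm 7.1 (`ThmWCRec`, from [CD]) — quantifier shape, verbatim order** (l.6820–6822): "Fix `v^𝓒 ∈ (0,1)` and
`C₀ > 0`.  Then there exist `e^𝓒 ∈ (0,1)` and a stationary past timelike 1-form `𝔡^𝓒` … such that for all
sufficiently large `γ^𝓒 > 1`, the following statements hold … provided `b` sufficiently close to `b₀`": items
(1) mode stability `σ ≠ 0` ([CD] Thm T), (2) enhanced mode stability at `σ = 0` on `α ∈ [−C₀−3/2, −1/2)`,
(3) indicial roots `Re λ ≥ 1` or `< −C₀`, only `λ = 1` on `Re λ = 1` ([CD] Thm M0), (4) tf-admissibility for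
`β ∈ [−C₀, 1)` ([CD] Thm MiInv) — packaged as `S.CD`.
[cite: Hintz2026, Thm 7.1, TeX l.6820-6834 (transcription; claim under review)] -/
def Thm71Shape (S : Setting) : Prop :=
  ∀ vC : ℝ, 0 < vC → vC < 1 → ∀ C0 : ℝ, 0 < C0 →
    ∃ eC : ℝ, 0 < eC ∧ eC < 1 ∧ ∃ γ₀ : ℝ, 1 ≤ γ₀ ∧ ∀ γC : ℝ, γ₀ < γC → S.CD ⟨vC, eC, γC, C0⟩

/-- **Prop 6.12 (`PropWGMode`) — quantifier shape, verbatim order** (l.6196–6199): "Fix `𝔡^Υ_{𝓗⁺}` as in Lemma 6.11,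
and fix `𝔡^Υ` … Then there exists `ε₀ > 0` such that for all `γ^Υ_{𝓗⁺} ∈ (0, ε₀]` there exists `ε₁ > 0` such that
for all `e^Υ ∈ [0, ε₁]` and `|γ^Υ| < ε₁`, mode stability holds for the operator `□^Υ_{g_b,E^Υ}` … for all
frequencies `σ ∈ ℂ`, `Im σ ≥ 0`" (this `ε₀` is local to Prop 6.12, unrelated to Thm 13.1's).  "The order of the
choice of parameters reflects the proof" (l.6201).
[cite: Hintz2026, Prop 6.12, TeX l.6196-6201 (transcription; claim under review)] -/
def Prop612Shape (S : Setting) : Prop :=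
  ∃ ε612 : ℝ, 0 < ε612 ∧ ∀ γH : ℝ, 0 < γH → γH ≤ ε612 →
    ∃ ε₁ : ℝ, 0 < ε₁ ∧ ∀ eU γU : ℝ, 0 ≤ eU → eU ≤ ε₁ → |γU| < ε₁ → S.MSU ⟨eU, γU, γH⟩

/-- **Prop 8.6 (`PropWEtf`) — quantifier shape, verbatim order** (l.7653–7655): "For all sufficiently small values of
`γ^Υ > 0` in Definition 4.1 (while keeping the other parameters and all 1-forms fixed), the operator `L_b` is
tf-admissible with weight `β ∈ (0, ε_ind)`": the threshold may depend on everything fixed before (`E^𝓒`, `e^Υ`,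
`γ^Υ_{𝓗⁺}`, the 1-forms), but not on `γ^Υ`.
[cite: Hintz2026, Prop 8.6, TeX l.7653-7660 (transcription; claim under review)] -/
def Prop86Shape (S : Setting) : Prop :=
  ∀ (c : CDParams) (eU γH : ℝ), ∃ γ₂ : ℝ, 0 < γ₂ ∧ ∀ γU : ℝ, 0 < γU → γU < γ₂ → S.TF c ⟨eU, γU, γH⟩

/-- **Step 1 of the proof of Thm 13.1, as printed** (l.15119; the same fixing is the §8 preamble l.7244–7249 and
the §10 preamble l.9787): `E^𝓒` from Thm 7.1 "with `v^𝓒 = ½`, `C₀ = 100`, and `(1−e^𝓒)(1−v^𝓒)γ^𝓒 > 100`";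
`𝔡^Υ, 𝔡^Υ_{𝓗⁺}` as in Lemma 6.11 / Prop 6.12 and "`e^Υ, γ^Υ, γ^Υ_{𝓗⁺} > 0` small enough so that the conclusions of
Proposition 6.12 … as well as of Proposition 8.6 … hold.  We moreover require `γ^Υ` to be so small that
`1 + 2γ^Υ < min Re 𝓔₀`."  [cite: Hintz2026, proof of Thm 13.1 Step 1, TeX l.15119; §8 preamble l.7241-7252] -/
def Step1 (S : Setting) (c : CDParams) (g : GaugeParams) : Prop :=
  (c.vC = 1 / 2 ∧ c.C0 = 100 ∧ 0 < c.eC ∧ c.eC < 1 ∧ 1 < c.γC ∧ 100 < (1 - c.eC) * (1 - c.vC) * c.γC ∧ S.CD c) ∧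
    (0 < g.γH ∧ 0 < g.eU ∧ 0 < g.γU ∧ S.MSU g ∧ S.TF c g ∧ 1 + 2 * g.γU < S.minReE0)

/-- **Step 1 is consistent as printed (parameter order acyclic).**  From the printed quantifier shapes of Thm 7.1,
Prop 6.12 and Prop 8.6, and from `min Re 𝓔₀ > 1 + ε₀ > 1`, parameters satisfying every clause of `Step1` exist:
choose `E^𝓒` first (any `γ^𝓒` beyond both thresholds), then `γ^Υ_{𝓗⁺} := ε₀^{6.12}`, then `e^Υ := ε₁ > 0`, and only
then `γ^Υ` below `ε₁`, below Prop 8.6's threshold (which was allowed to depend on everything else) and below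
`(min Re 𝓔₀ − 1)/2`.  Pure bookkeeping; the three leaves are hypotheses.
[cite: Hintz2026, proof of Thm 13.1 Step 1, TeX l.15119] -/
theorem step1_exists (S : Setting) (h71 : Thm71Shape S) (h612 : Prop612Shape S) (h86 : Prop86Shape S) :
    ∃ (c : CDParams) (g : GaugeParams), Step1 S c g := by
  -- E^𝓒: `v^𝓒 = 1/2`, `C₀ = 100`
  obtain ⟨eC, heC0, heC1, γ₀, hγ₀, hCD⟩ := h71 (1 / 2) (by norm_num) (by norm_num) 100 (by norm_num)
  set γC : ℝ := γ₀ + 1 + 200 / (1 - eC) with hγC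
  have h1e : 0 < 1 - eC := by linarith
  have hdiv : 0 < 200 / (1 - eC) := div_pos (by norm_num) h1e
  have hγC_gt : γ₀ < γC := by rw [hγC]; linarith
  have hCDc := hCD γC hγC_gt
  -- E^Υ: `γ^Υ_{𝓗⁺}`, then `e^Υ`, then `γ^Υ`
  obtain ⟨ε612, hε612, H612⟩ := h612
  obtain ⟨ε₁, hε₁, H⟩ := H612 ε612 hε612 le_rfl
  obtain ⟨γ₂, hγ₂, H86⟩ := h86 ⟨1 / 2, eC, γC, 100⟩ ε₁ ε612
  have hE : 0 < (S.minReE0 - 1) / 2 := by linarith [S.minReE0_gt, S.ε0_pos]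
  set γU : ℝ := min ε₁ (min γ₂ ((S.minReE0 - 1) / 2)) / 2 with hγU
  have hm : 0 < min ε₁ (min γ₂ ((S.minReE0 - 1) / 2)) := lt_min hε₁ (lt_min hγ₂ hE)
  have hγU0 : 0 < γU := by rw [hγU]; linarith
  have hγU1 : γU < ε₁ := by
    have := min_le_left ε₁ (min γ₂ ((S.minReE0 - 1) / 2)); rw [hγU]; linarith
  have hγU2 : γU < γ₂ := by
    have := le_trans (min_le_right ε₁ _) (min_le_left γ₂ ((S.minReE0 - 1) / 2)); rw [hγU]; linarith
  have hγU3 : 1 + 2 * γU < S.minReE0 := by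
    have := le_trans (min_le_right ε₁ _) (min_le_right γ₂ ((S.minReE0 - 1) / 2)); rw [hγU]; linarith
  refine ⟨⟨1 / 2, eC, γC, 100⟩, ⟨ε₁, γU, ε612⟩, ⟨rfl, rfl, heC0, heC1, by linarith, ?_, hCDc⟩,
    hε612, hε₁, hγU0, ?_, ?_, hγU3⟩
  · -- `(1 − e^𝓒)(1 − 1/2) γ^𝓒 = (1−e^𝓒)(γ₀+1)/2 + 100 > 100`
    show 100 < (1 - eC) * (1 - 1 / 2) * γC
    have hkey : (1 - eC) * (1 - 1 / 2) * γC = (1 - eC) * (γ₀ + 1) / 2 + 100 := by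
      rw [hγC]; field_simp; ring
    rw [hkey]
    have : 0 < (1 - eC) * (γ₀ + 1) / 2 := by positivity
    linarith
  · exact H ε₁ γU hε₁.le le_rfl (by rw [abs_of_pos hγU0]; exact hγU1)
  · exact H86 γU hγU0 hγU2

/-- **Step 1 together with the hypothesis Lemma 6.6 leaves implicit.**  The simplicity clause of Lemma 6.6 (indicial
roots of `□^Υ`) holds exactly for `0 ≤ e^Υ(γ^Υ)² < 3/4` (`Hintz2026/IndicialRoots.lean`, `all_simple_of_lt`,
`det_Ns0_double_root`); the printed order lets one secure it for free (shrink `γ^Υ` after `e^Υ` is fixed).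
[cite: Hintz2026, proof of Thm 13.1 Step 1, TeX l.15119; Lemma 6.6 l.6043; l.6069] -/
theorem step1_exists' (S : Setting) (h71 : Thm71Shape S) (h612 : Prop612Shape S) (h86 : Prop86Shape S) :
    ∃ (c : CDParams) (g : GaugeParams), Step1 S c g ∧ g.eU * g.γU ^ 2 < 3 / 4 := by
  obtain ⟨eC, heC0, heC1, γ₀, hγ₀, hCD⟩ := h71 (1 / 2) (by norm_num) (by norm_num) 100 (by norm_num)
  set γC : ℝ := γ₀ + 1 + 200 / (1 - eC) with hγC
  have h1e : 0 < 1 - eC := by linarith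
  have hdiv : 0 < 200 / (1 - eC) := div_pos (by norm_num) h1e
  have hγC_gt : γ₀ < γC := by rw [hγC]; linarith
  have hCDc := hCD γC hγC_gt
  obtain ⟨ε612, hε612, H612⟩ := h612
  obtain ⟨ε₁, hε₁, H⟩ := H612 ε612 hε612 le_rfl
  obtain ⟨γ₂, hγ₂, H86⟩ := h86 ⟨1 / 2, eC, γC, 100⟩ ε₁ ε612
  have hE : 0 < (S.minReE0 - 1) / 2 := by linarith [S.minReE0_gt, S.ε0_pos]
  -- extra threshold `γ^Υ < 1/(2(1+ε₁))` gives `ε₁ γ² ≤ ε₁ γ < 3/4`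
  have hx : 0 < 1 / (2 * (1 + ε₁)) := by positivity
  set μ : ℝ := min (min ε₁ (min γ₂ ((S.minReE0 - 1) / 2))) (min 1 (1 / (2 * (1 + ε₁)))) with hμ
  have hm : 0 < μ := by
    rw [hμ]; exact lt_min (lt_min hε₁ (lt_min hγ₂ hE)) (lt_min one_pos hx)
  set γU : ℝ := μ / 2 with hγU
  have hγU0 : 0 < γU := by rw [hγU]; linarith
  have hμ1 : μ ≤ ε₁ := le_trans (min_le_left _ _) (min_le_left _ _)
  have hμ2 : μ ≤ γ₂ := le_trans (min_le_left _ _) (le_trans (min_le_right _ _) (min_le_left _ _))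
  have hμ3 : μ ≤ (S.minReE0 - 1) / 2 :=
    le_trans (min_le_left _ _) (le_trans (min_le_right _ _) (min_le_right _ _))
  have hμ4 : μ ≤ 1 := le_trans (min_le_right _ _) (min_le_left _ _)
  have hμ5 : μ ≤ 1 / (2 * (1 + ε₁)) := le_trans (min_le_right _ _) (min_le_right _ _)
  have hγU1 : γU < ε₁ := by rw [hγU]; linarith
  have hγU2 : γU < γ₂ := by rw [hγU]; linarith
  have hγU3 : 1 + 2 * γU < S.minReE0 := by rw [hγU]; linarith
  refine ⟨⟨1 / 2, eC, γC, 100⟩, ⟨ε₁, γU, ε612⟩, ⟨⟨rfl, rfl, heC0, heC1, by linarith, ?_, hCDc⟩,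
    hε612, hε₁, hγU0, ?_, ?_, hγU3⟩, ?_⟩
  · show 100 < (1 - eC) * (1 - 1 / 2) * γC
    have hkey : (1 - eC) * (1 - 1 / 2) * γC = (1 - eC) * (γ₀ + 1) / 2 + 100 := by
      rw [hγC]; field_simp; ring
    rw [hkey]
    have : 0 < (1 - eC) * (γ₀ + 1) / 2 := by positivity
    linarith
  · exact H ε₁ γU hε₁.le le_rfl (by rw [abs_of_pos hγU0]; exact hγU1)
  · exact H86 γU hγU0 hγU2
  · -- `ε₁ γU² ≤ ε₁ γU` (as `γU ≤ 1`) and `ε₁ γU ≤ ε₁ μ/2 ≤ ε₁/(4(1+ε₁)) < 3/4`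
    show ε₁ * γU ^ 2 < 3 / 4
    have hγle1 : γU ≤ 1 := by rw [hγU]; linarith
    have h1 : ε₁ * γU ^ 2 ≤ ε₁ * γU := by
      have : γU ^ 2 ≤ γU := by nlinarith
      exact mul_le_mul_of_nonneg_left this hε₁.le
    have h2 : ε₁ * γU ≤ ε₁ * (1 / (2 * (1 + ε₁))) / 2 := by
      have : γU ≤ (1 / (2 * (1 + ε₁))) / 2 := by rw [hγU]; linarith
      nlinarith
    have h3 : ε₁ * (1 / (2 * (1 + ε₁))) / 2 < 3 / 4 := by
      rw [div_lt_iff₀ (by norm_num : (0 : ℝ) < 2)]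
      have : ε₁ * (1 / (2 * (1 + ε₁))) < 1 := by
        rw [mul_one_div, div_lt_one (by positivity)]
        linarith
      linarith
    linarith

/-! ## The parameter windows of Thm 10.1, Cor 11.10, Thm 11.12 -/

/-- **The weight windows are inhabited.**  Thm 10.1 (l.9789–9792): `α_𝒮 + 3/2 ∈ (0, ε_ind)`, `δ > α_𝒮 + 3/2`, with
"δ … can be taken to be `< ε_ind` (and thus `< 1`)" (l.11008); Cor 11.10 (l.11010–11013): `ℓ_𝒥 < min(2γ^Υ, ½)`,
`ℓ₊ ∈ (δ, 1)`, `ℓ_𝒦 ∈ (2, 2+ε_𝒦]`; Thm 11.12 (l.11028): `β₊ ∈ (½, ½+ε_ind)`, `β_𝒥 ∈ (β₊, 1)`, `δ > β₊ − ½`.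
All three are inhabited (with POSITIVE `ℓ_𝒥`) as soon as `0 < ε_ind ≤ 1`, `γ^Υ > 0`, `ε_𝒦 > 0` — the first
from Lemma 8.4 (`ε_ind > 0`; `≤ 1` since `1` is an `s0` root, l.7549), the others from Step 1 and Thm 12.3.
[cite: Hintz2026, Thm 10.1 l.9789-9792; l.11008; Cor 11.10 l.11010-11013; Thm 11.12 l.11026-11028] -/
theorem windows_nonempty {εind γU εK : ℝ} (hind : 0 < εind) (hind1 : εind ≤ 1) (hγ : 0 < γU) (hK : 0 < εK) :
    (∃ αs δ : ℝ, 0 < αs + 3 / 2 ∧ αs + 3 / 2 < εind ∧ αs + 3 / 2 < δ ∧ δ < εind) ∧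
      (∃ δ ℓscri ℓplus ℓK : ℝ, 0 < δ ∧ δ < εind ∧ 0 < ℓscri ∧ ℓscri < min (2 * γU) (1 / 2) ∧
          δ < ℓplus ∧ ℓplus < 1 ∧ 2 < ℓK ∧ ℓK ≤ 2 + εK) ∧
        (∃ βp βscri δ : ℝ, 1 / 2 < βp ∧ βp < 1 / 2 + εind ∧ βp < βscri ∧ βscri < 1 ∧ βp - 1 / 2 < δ ∧
          δ < εind) := by
  have hm : 0 < min (2 * γU) (1 / 2) := lt_min (by linarith) (by norm_num)
  refine ⟨⟨εind / 3 - 3 / 2, εind / 2, by linarith, by linarith, by linarith, by linarith⟩,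
    ⟨εind / 2, min (2 * γU) (1 / 2) / 2, (εind / 2 + 1) / 2, 2 + εK, by linarith, by linarith, by linarith,
      by linarith, by linarith, by linarith, by linarith, le_rfl⟩,
    ⟨1 / 2 + εind / 3, 3 / 4 + εind / 6, εind / 2, by linarith, by linarith, by linarith, by linarith,
      by linarith, by linarith⟩⟩

/-! ## Prop 8.8: the printed proof is bookkeeping modulo five named inputs -/

/-- **Abstract mode data at one frequency `σ ≠ 0`, `Im σ ≥ 0`** for the proof of Prop 8.8 (l.7746–7757):
symmetric-2-tensor modes `U` and 1-form modes `W` on `X` with their conormal weight filtrations `𝒜^α`, the kernel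
conditions of `L̂_b(σ)`, `□^𝓒(σ)^`, `□^Υ(σ)^`, of `D_{g_b}Ric` on `e^{-iσt_*}u`, and the two maps
`u ↦ η := δ̂_{g_b,E^Υ}(σ) 𝖦_{g_b} u` and `ω ↦ δ̂*_{g_b}(σ) ω`.  Bare sets and maps: a bookkeeping carrier.
[cite: Hintz2026, proof of Prop 8.8, TeX l.7746-7757 (transcription; claim under review)] -/
structure ModeData where
  /-- modes of symmetric 2-tensors. -/
  U : Type
  /-- modes of 1-forms. -/
  W : Type
  /-- the zero tensor mode. -/
  zU : U
  /-- the zero 1-form mode. -/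
  zW : W
  /-- `u ∈ 𝒜^α(X; S²T*X)`. -/
  inAU : ℝ → U → Prop
  /-- `ω ∈ 𝒜^α(X; T*X)`. -/
  inAW : ℝ → W → Prop
  /-- `L̂_b(σ) u = 0`. -/
  kerL : U → Prop
  /-- `u ↦ η = δ̂_{g_b,E^Υ}(σ) 𝖦_{g_b} u` (l.7750). -/
  eta : U → W
  /-- `□^𝓒_{g_b,E^𝓒}(σ)^ η = 0`. -/
  kerBoxC : W → Prop
  /-- `D_{g_b}Ric(e^{-iσt_*} u) = 0` (l.7751). -/
  kerDRic : U → Prop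
  /-- `ω ↦ δ̂*_{g_b}(σ) ω` (l.7752). -/
  dstar : W → U
  /-- `□^Υ_{g_b,E^Υ}(σ)^ ω = 0` (l.7754). -/
  kerBoxU : W → Prop

/-- **Prop 8.8 (`PropWEMode`), injectivity part, PROVED from its five printed inputs.**  Verbatim chain
(l.7748–7756): given `u ∈ 𝒜^α` with `L̂_b(σ)u = 0`, "applying `δ_{g_b}𝖦_{g_b}` … and using the second Bianchi
identity … yields `□^𝓒(σ)^ η = 0`, `η := δ̂_{g_b,E^Υ}(σ)𝖦_{g_b}u ∈ 𝒜^{α+1}`" (`hBianchi`, `hEtaWeight`); "By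
Theorem 7.1(1), this implies `η = 0`" (`h71`, for ALL weights); "Therefore `D_{g_b}Ric(e^{-iσt_*}u) = 0`" (`hGauge`:
the definition of `L_b`, eq. `EqWEOp` l.7248–7251); "By [AHW, Thm 6.1(1)], we obtain `u = δ̂*_{g_b}(σ)ω` where `ω ∈ 𝒜^{α'}` for some
`α'`" (`hAHW`); "But then `η = 0` implies `□^Υ(σ)^ ω = 0`" (`hBoxU`: `□^Υ = 2δ_{E^Υ}𝖦δ*`, eq. `Eq1BoxUps` l.4175–4178); "Mode
stability for `□^Υ` (Proposition 6.12) implies that `ω = 0`" (`h612`, needed for EVERY weight `α'` since AHW does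
not control it) "and hence `u = 0`" (`hdstar0`).  The invertibility clause of Prop 8.8 (Fredholm index `0` from
Prop 8.3 + [AF] Thm SpB) is not typed. [cite: Hintz2026, Prop 8.8 and its proof, TeX l.7739-7757] -/
theorem propWEMode_injective (D : ModeData)
    (hBianchi : ∀ u, D.kerL u → D.kerBoxC (D.eta u))
    (hEtaWeight : ∀ α u, D.inAU α u → D.inAW (α + 1) (D.eta u))
    (h71 : ∀ γ η, D.inAW γ η → D.kerBoxC η → η = D.zW)
    (hGauge : ∀ u, D.kerL u → D.eta u = D.zW → D.kerDRic u)
    (hAHW : ∀ α u, D.inAU α u → D.kerDRic u → ∃ (α' : ℝ) (ω : D.W), D.inAW α' ω ∧ u = D.dstar ω)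
    (hBoxU : ∀ ω, D.eta (D.dstar ω) = D.zW → D.kerBoxU ω)
    (h612 : ∀ α' ω, D.inAW α' ω → D.kerBoxU ω → ω = D.zW)
    (hdstar0 : D.dstar D.zW = D.zU) :
    ∀ α u, D.inAU α u → D.kerL u → u = D.zU := by
  intro α u hu hL
  have hη : D.eta u = D.zW := h71 (α + 1) (D.eta u) (hEtaWeight α u hu) (hBianchi u hL)
  obtain ⟨α', ω, hω, rfl⟩ := hAHW α u hu (hGauge u hL hη)
  have hω0 : ω = D.zW := h612 α' ω hω (hBoxU ω hη)
  rw [hω0, hdstar0]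

/-! ## Thm 11.12 ⇐ [AF] Thm F ∘ admissibility (Cor 11.10 ⇐ Thm 10.1 ⇐ Props 8.3, 8.6 + low energy; Prop 11.6) -/

/-- **Node list of the linear spine below Thm 11.12, with the printed edges composed.**  Thm 11.12 (`ThmDAdmReg`,
l.11026–11050) "We state [AF, Theorem F]" for `L_{g,g⁰}` — its hypothesis is admissibility relative to `L_b`
(Cor 11.10 `CorDAdm`, l.11010–11013), which "demands" (l.9794): strong trapping admissibility (Prop 8.3 `PropWETr`),
tf-admissibility (Prop 8.6 `PropWEtf`), the quantitative low-energy forward estimate of §10 (Props 10.6–10.7) —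
together Thm 10.1 (`ThmAdm`, 2-admissibility, l.9789–9792) — plus the structure of `L_{g,g⁰}` on the forward cone
(Prop 11.6 `PropDAdmLin`).  Over abstract propositions for these seven nodes the composition is modus ponens; the
theorem records the node list and which node consumes which.
[cite: Hintz2026, Thm 10.1 l.9789-9794; Cor 11.10 l.11008-11013; Thm 11.12 l.11024-11050] -/
theorem thm1112_of_leaves {STA TF LowEnergy Adm2 DAdmLin Admissible FwdReg : Prop}
    (thm101 : STA → TF → LowEnergy → Adm2) (cor1110 : Adm2 → DAdmLin → Admissible)
    (AF_ThmF : Admissible → FwdReg) (h83 : STA) (h86 : TF) (h10 : LowEnergy) (h116 : DAdmLin) : FwdReg :=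
  AF_ThmF (cor1110 (thm101 h83 h86 h10) h116)

/-! ## Step 2 (l.15124–15156): Thm 5.21's hypotheses at `ℓ₀ = 3 + ε₀`, `ℓ_𝒥 = 3 + ε_𝒥` -/

/-- **The numeric hypotheses of Thm 5.21 (`ThmExPhg`, l.5317–5322) at the Step-2 values follow from Step 1.**
Thm 5.21 requires `min Re 𝓔₀ > 1 + 2γ^Υ`, `ℓ₀, ℓ_𝒥 > 1`, `ℓ_𝒥 < ℓ₀`, `ℓ_𝒥 < 1 + (1−e^𝓒)(1−v^𝓒)γ^𝓒` (and
`ℓ₀ ∉ Re π₁𝓔₀`, see `SideCond521`); Step 2 applies it with `ℓ₀ = 3 + ε₀`, `ℓ_𝒥 = 3 + ε_𝒥`, `0 < ε_𝒥 < ε₀`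
(l.15040, l.15124).  Given `Step1` all but the last follow, the `γ^𝓒`-clause with the printed margin
(`1 + (1−e^𝓒)(1−v^𝓒)γ^𝓒 > 101 > 3 + ε_𝒥` needs `ε_𝒥 < 98`, implied by `ε_𝒥 < ε₀ < min Re 𝓔₀ − 1 …`; we assume
the printed `ε_𝒥 < ε₀` and `ε₀ < 98` is NOT needed: `ε_𝒥 < ε₀` and `1 + 2γ^Υ < min Re 𝓔₀` do not bound `ε₀`, so the
clause is proved from `100 < (1−e^𝓒)(1−v^𝓒)γ^𝓒` under the extra harmless bound `ε_𝒥 < 98`).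
[cite: Hintz2026, Thm 5.21 l.5317-5322; proof of Thm 13.1 Step 2 l.15124] -/
theorem thm521_numeric_hyps_of_step1 (S : Setting) {c : CDParams} {g : GaugeParams} (h : Step1 S c g)
    {εscri : ℝ} (hs0 : 0 < εscri) (hs1 : εscri < S.ε0) (hs98 : εscri < 98) :
    1 + 2 * g.γU < S.minReE0 ∧ 1 < 3 + S.ε0 ∧ 1 < 3 + εscri ∧ 3 + εscri < 3 + S.ε0 ∧
      3 + εscri < 1 + (1 - c.eC) * (1 - c.vC) * c.γC := by
  obtain ⟨⟨_, _, _, _, _, h100, _⟩, _, _, _, _, _, hE⟩ := h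
  exact ⟨hE, by linarith [S.ε0_pos], by linarith, by linarith, by linarith⟩

/-- **The side condition of Thm 5.21 that Step 2 does not discharge.**  Thm 5.21 is stated for "`ℓ₀ ∉ Re π₁𝓔₀`"
(l.5319); Step 2 (l.15124) applies it at `ℓ₀ = 3 + ε₀`, and Thm 13.1's hypotheses on `𝓔₀` ("`min Re 𝓔₀ > 1+ε₀`
and `j𝓔₀ ⊂ 𝓔₀`", l.15040) do not exclude `3 + ε₀ ∈ Re π₁𝓔₀`.  Carried as an explicit hypothesis of the Step-2 edge;
`sideCond521_repairable` is the one-line repair.  (Audit cell `pub-kerr`, GAPS.md observation Q-H1: not an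
objection.) [cite: Hintz2026, Thm 5.21 l.5319; Thm 13.1 l.15040; proof Step 2 l.15124] -/
def SideCond521 (S : Setting) : Prop := 3 + S.ε0 ∉ S.ReExpE0

/-- **Repair of the side condition: shrink `ε₀`.**  Because `Re π₁𝓔₀` is locally finite (index sets have finitely
many exponents with `Re z ≤ C`, l.2366), every interval `(ε₀/2, ε₀)` contains an `ε₀'` with
`3 + ε₀' ∉ Re π₁𝓔₀`; the data hypotheses (13.1a)–(13.1b) for `ε₀` imply those for `ε₀'`, `min Re 𝓔₀ > 1 + ε₀'`
persists, and only the `I⁰`-order in the conclusion (13.3) weakens from `3+ε₀` to `3+ε₀'` (Thm 1.1 is unaffected).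
This theorem is the real-line fact used. [folklore] -/
theorem sideCond521_repairable (E : Set ℝ) (hE : ∀ C : ℝ, (E ∩ Set.Iic C).Finite) {ε0 : ℝ} (h0 : 0 < ε0) :
    ∃ ε0' : ℝ, ε0 / 2 < ε0' ∧ ε0' < ε0 ∧ 3 + ε0' ∉ E := by
  have hinf : (Set.Ioo (3 + ε0 / 2) (3 + ε0)).Infinite := Set.Ioo_infinite (by linarith)
  obtain ⟨x, hxI, hxE⟩ := (hinf.sdiff (hE (3 + ε0))).nonempty
  refine ⟨x - 3, by linarith [hxI.1], by linarith [hxI.2], ?_⟩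
  intro hx
  have : x ∈ E ∩ Set.Iic (3 + ε0) := ⟨by simpa using hx, hxI.2.le⟩
  exact hxE this

/-! ## Steps 2–4 and the reduction Thm 1.1 ⇐ Thm 13.1: the node list, composed -/

/-- **The nodes of Steps 2–4 of the proof of Thm 13.1 as abstract propositions** (each field = the conclusion of
the named printed statement in the instance the proof uses; loci in the field docstrings).  A bookkeeping
carrier: nothing is asserted. [cite: Hintz2026, proof of Thm 13.1 Steps 2-4, TeX l.15124-15214 (transcription; claim under review)] -/
structure NMNodes where
  /-- Prop 5.25 `PropExID` (l.5717–5734): gauged Cauchy data `h₀, h₁ ∈ H_b^{∞,(𝓔₀,3+ε₀)}(Σ_IVP)` from `(γ,k)`,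
  continuous in the data, `Υ₀ = 0` at `Σ_IVP`. -/
  gaugedData : Prop
  /-- Thm 5.21 `ThmExPhg` (l.5317–5339) at `ℓ₀ = 3+ε₀`, `ℓ_𝒥 = 3+ε_𝒥`: exterior solution
  `h ∈ H_b^{∞,(𝓔₀,3+ε₀),(⟨𝓔^𝓒_𝒥⟩,3+ε_𝒥)}(Ω_{ext,r₀})` with the smallness transfer eq. `EqExPhgSmall` (l.5333–5338). -/
  exterior : Prop
  /-- Thm 5.23 `ThmExBoStab` (l.5675–5692) + "standard local well-posedness" (l.15134): the boosted family `h_𝔰`,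
  `𝔰 ∈ 𝐒₁` small, solving eq. `EqStIVPPullback` (l.15142–15151), defined and small on `φ_𝔰({t_IVP ≥ 0}) ∩ {𝔱_* ≤ 2}`,
  with `h_𝔰 = φ_𝔰^* h` near `Σ_IVP` (Step 2 output, l.15136–15156). -/
  boostedFamily : Prop
  /-- Thm 12.3 `ThmEfP` (l.14701–14727): the map `Φ` (and `Ψ`, eq. `EqStPsi` l.15161–15164) — Saint-Raymond check (1),
  "`P∘Ψ` maps a neighborhood of `0` in `𝔇^∞` to … `𝐁^∞` … in a `𝒞²` manner" (l.15173). -/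
  efP : Prop
  /-- Saint-Raymond check (2): tame estimates for `P∘Ψ`, "as usual, from Moser-type estimates … The key input here
  is that `Φ` satisfies such tame estimates" (l.15174) — asserted in prose. -/
  tameFwd : Prop
  /-- Thm 12.8 `ThmEfS` (l.14786–14802): linearised solvability `D_{Ψ(U)}P(D_UΨ(U')) = f` with tame estimates —
  Saint-Raymond check (3) (l.15175–15179), "the output of which Theorem 12.8 merely repackages" Cor 11.66. -/
  efS : Prop
  /-- Saint-Raymond check (4): smoothing operators on the b-Sobolev / partially polyhomogeneous components of `U`
  ("essentially standard"; Gluing II Lemma 6.12 / Cor 6.14, l.15180). -/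
  smoothing : Prop
  /-- "`P(Ψ(0))` is sufficiently small in `𝐁^∞` with respect to some fixed high-regularity norm — which is the case
  under the assumption (13.1b) when `d` there is sufficiently large and `ε > 0` is sufficiently small" (l.15183;
  via eq. `EqExPhgSmall` and `Φ(0) = 0`, l.15165). -/
  smallInitialError : Prop
  /-- conclusion of the main result of Saint-Raymond [SR89] for `P∘Ψ`: "a small `U ∈ 𝔇^∞` such that
  `P(Ψ(U)) = 0`", `supp h̃ ⊂ {𝔱_* ≥ 3/2}` (l.15183). -/
  nmSolution : Prop
  /-- Step 4 (l.15186–15214): the two-piece metric `g` is consistently defined, attains `(φ_𝔰)_*(γ,k)` at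
  `φ_𝔰(Σ_IVP)`, the gauge 1-form `η` vanishes with its normal derivative there (constraint equations), satisfies
  the homogeneous equation `δ_g𝖦_gδ*_{g⁰,E^𝓒}η = 0` (second Bianchi identity applied to eq. `EqStRic`, l.15205–15208), hence
  `η = 0` and `Ric(g) = 0`; decay orders (13.3) read off. -/
  gluedRicciFlat : Prop
  /-- the conclusion of Thm 13.1 (`ThmSt`, l.15055–15068): `b`, `𝔰`, `h` in the space (13.3), `g = g_{b₀,b,−𝔰} + h`
  attains the data and `Ric(g) = 0`. -/
  thmSt : Prop
  /-- the conclusion of Thm 1.1 (`ThmISimple`, l.1036–1043). -/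
  thm11 : Prop

/-- **Step 3 as printed (l.15160–15183): the Saint-Raymond scheme applied to `P∘Ψ`.**  "We check the assumptions
of the main result of [SR89]": (1) ⇐ Thm 12.3, (2) tame forward estimates, (3) ⇐ Thm 12.8, (4) smoothing
operators; "By the main result of [SR89], then, we can find a small `U ∈ 𝔇^∞` such that `P(Ψ(U)) = 0`, provided
`P(Ψ(0))` is sufficiently small".  The leaf `saintRaymond` is the cited theorem in exactly this four-hypothesis
shape; the edge is its application. [cite: Hintz2026, proof of Thm 13.1 Step 3, TeX l.15160-15183] -/
theorem step3_nmSolution (N : NMNodes)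
    (saintRaymond : N.efP → N.tameFwd → N.efS → N.smoothing → N.smallInitialError → N.nmSolution)
    (h123 : N.efP) (htame : N.tameFwd) (h128 : N.efS) (hsm : N.smoothing) (hsmall : N.smallInitialError) :
    N.nmSolution :=
  saintRaymond h123 htame h128 hsm hsmall

/-- **Thm 13.1 from Steps 1–4, and Thm 1.1 from Thm 13.1 — the spine composed.**  Edges, each a named hypothesis
with its locus: Step 2 `gaugedData → exterior → boostedFamily` (Prop 5.25 → Thm 5.21 [needs Step 1's
`1 + 2γ^Υ < min Re 𝓔₀`, the `γ^𝓒`-margin, and `SideCond521`] → Thm 5.23 + local well-posedness);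
`boostedFamily ∧ (13.1b) → smallInitialError` (l.15165, l.15183); Step 3 (`step3_nmSolution`); Step 4
`nmSolution → boostedFamily → gluedRicciFlat → thmSt` (l.15186–15214); `thmSt → thm11` ("follows from Theorem 13.1 …
by pulling back the metric … along a diffeomorphism of `M`", l.15080).  Over abstract propositions this is modus
ponens; its content is the node/edge list. [cite: Hintz2026, proof of Thm 13.1 Steps 1-4, TeX l.15117-15215; l.15080] -/
theorem thmSt_of_steps (S : Setting) (N : NMNodes) {c : CDParams} {g : GaugeParams}
    (_step1 : Step1 S c g) (_side : SideCond521 S)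
    (prop525 : N.gaugedData)
    (thm521 : Step1 S c g → SideCond521 S → N.gaugedData → N.exterior)
    (thm523 : N.exterior → N.boostedFamily)
    (small0 : N.boostedFamily → N.smallInitialError)
    (thm123 : Step1 S c g → N.efP) (tame : N.tameFwd) (thm128 : Step1 S c g → N.efS) (smooth : N.smoothing)
    (saintRaymond : N.efP → N.tameFwd → N.efS → N.smoothing → N.smallInitialError → N.nmSolution)
    (step4 : N.nmSolution → N.boostedFamily → N.gluedRicciFlat)
    (readOff : N.gluedRicciFlat → N.thmSt) (pullback : N.thmSt → N.thm11) :
    N.thmSt ∧ N.thm11 := by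
  have hext : N.exterior := thm521 _step1 _side prop525
  have hfam : N.boostedFamily := thm523 hext
  have hsol : N.nmSolution :=
    step3_nmSolution N saintRaymond (thm123 _step1) tame (thm128 _step1) smooth (small0 hfam)
  have hSt : N.thmSt := readOff (step4 hsol hfam)
  exact ⟨hSt, pullback hSt⟩

end Literature.Geometry.Lorentzian.Hintz2026.Architecture
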